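import Mathlib
import Summits.PneNP.PneNP.Theorems.ClusUniversalCertificateCoordZeroFree

/-!
# Route ClusUniversalCertificate, crux `UniversalCertAll` (stmt-PneNP-19683) — the BOX LEMMA (tight case of the flat lemma)

Support file (`--supports stmt-PneNP-19683`); objects of record `…Theorems.ClusCoord`, block projection and FLAT LEMMA of
`ClusUniversalCertificateCoordZeroFree.lean` (`finrank_direction_add_card_le`: a flat avoiding the zero pattern of every block of `J` has
`dim + |J| ≤ M`).

**Box lemma (`mem_direction_of_tight`).**  If the flat lemma is TIGHT for `A` and `J` (`dim A + |J| = M`), then the direction of `A`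
contains every vector supported in a block outside `J`: `A` is saturated in every block `k ∉ J` (it is the box `π_J(A) × Π_{k ∉ J} V_k`).
Proof: the functionals `f_j ∘ π_j` (`j ∈ J`, `exists_dual_blockProj`) give an onto map `Ψ : 𝔽₂^M → 𝔽₂^J` killing `A.direction`; tightness and
rank–nullity force `A.direction = ker Ψ`, and `ker Ψ` contains every vector vanishing on the blocks of `J`.
**Corollary (`sat_of_tight`).**  Under the same hypotheses with `A ⊆ Y`, every point `a ∈ A` is `k`-saturated in `Y` for every `k ∉ J`
(`a + w ∈ Y` for all `w` supported in block `k`).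

USE (line `slicing`, stub `stub_core`; Hall level `|J| = 1` of the positive-part certificate `UC⁺`).  A point of certificate codimension
`n − 1` whose optimal flat is onto no block other than `j` has a flat avoiding (after a block-wise translation) the zero pattern of the
`n − 1` other blocks with `dim = M − (n − 1)`, hence is `j`-saturated; with the saturation bound (`ClusCoordSaturation.card_sat_le_zcount`,
`#{j-saturated} ≤ 2^{b_j} Z_j`) this settles the level-one Hall inequality.  HONEST FRAMING: a support lemma; the crux is OPEN; FRONTIER rung
F-N1 — nothing here bears on P vs NP.
-/

set_option linter.dupNamespace false -- `Summit.PneNP.PneNP.…`: summit = sub-problem name (D-0017 single-conjunct layout)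

namespace Summit.PneNP.PneNP.Theorems.ClusCoordBox

open Finset
open Summit.PneNP.PneNP.Theorems.ClusCoord (bsize zcount)
open Summit.PneNP.PneNP.Theorems.ClusCoordZeroFree (blockProj blockProj_apply blockProj_eq_zero_iff blockProj_blockProj_self
  blockProj_blockProj_of_ne exists_dual_blockProj finrank_direction_add_card_le)

variable {M n : ℕ}

/-- **Box lemma.**  If a flat through `y` avoids the zero pattern of every block of `J` and the flat lemma is tight
(`dim + |J| = M`), then its direction contains every vector supported outside the blocks of `J`. -/
theorem mem_direction_of_tight (blk : Fin M → Fin n) (A : AffineSubspace (ZMod 2) (Fin M → ZMod 2))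
    (y : Fin M → ZMod 2) (hy : y ∈ A) (J : Finset (Fin n))
    (hJ : ∀ j ∈ J, ∀ z ∈ A, ¬ (∀ i, blk i = j → z i = 0))
    (htight : M ≤ Module.finrank (ZMod 2) A.direction + J.card)
    (w : Fin M → ZMod 2) (hw : ∀ i, blk i ∈ J → w i = 0) : w ∈ A.direction := by
  have hf : ∀ j : J, ∃ f : Module.Dual (ZMod 2) (Fin M → ZMod 2),
      (∀ d ∈ A.direction, f (blockProj blk j d) = 0) ∧ f (blockProj blk j y) = 1 :=
    fun j => exists_dual_blockProj blk A y hy j (hJ j j.2)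
  choose f hf0 hf1 using hf
  let Ψ : (Fin M → ZMod 2) →ₗ[ZMod 2] (J → ZMod 2) := LinearMap.pi fun j : J => (f j).comp (blockProj blk j)
  have hΨ : ∀ v : Fin M → ZMod 2, ∀ j : J, Ψ v j = f j (blockProj blk j v) := fun v j => rfl
  have hker : A.direction ≤ LinearMap.ker Ψ := by
    intro d hd
    rw [LinearMap.mem_ker]
    funext j
    rw [hΨ, hf0 j d hd]
    rfl
  have hsingle : ∀ j₀ : J, Ψ (blockProj blk j₀ y) = Pi.single j₀ 1 := by
    intro j₀
    funext j
    rw [hΨ]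
    by_cases h : j = j₀
    · subst h
      rw [blockProj_blockProj_self, hf1, Pi.single_eq_same]
    · have hne : (j : Fin n) ≠ (j₀ : Fin n) := fun h' => h (Subtype.ext h')
      rw [blockProj_blockProj_of_ne blk hne, map_zero, Pi.single_eq_of_ne h]
  have hrange : LinearMap.range Ψ = ⊤ := by
    rw [eq_top_iff]
    intro u _
    rw [pi_eq_sum_univ u]
    refine Submodule.sum_mem _ fun j _ => Submodule.smul_mem _ _ ?_
    have : (fun j' : J => if j = j' then (1 : ZMod 2) else 0) = Pi.single j 1 := by
      funext j'
      by_cases h : j = j'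
      · subst h; simp
      · rw [if_neg h, Pi.single_eq_of_ne (Ne.symm h)]
    rw [this, ← hsingle j]
    exact LinearMap.mem_range_self Ψ _
  have hrn := LinearMap.finrank_range_add_finrank_ker Ψ
  rw [hrange, finrank_top, Module.finrank_fintype_fun_eq_card, Module.finrank_fintype_fun_eq_card,
    Fintype.card_coe, Fintype.card_fin] at hrn
  -- tightness: `A.direction = ker Ψ`
  have heq : A.direction = LinearMap.ker Ψ := by
    apply Submodule.eq_of_le_of_finrank_le hker
    omega
  -- `w` vanishes on the blocks of `J`, so `Ψ w = 0`
  rw [heq, LinearMap.mem_ker]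
  funext j
  rw [hΨ]
  have : blockProj blk j w = 0 := by
    rw [blockProj_eq_zero_iff]
    intro i hi
    exact hw i (hi ▸ j.2)
  rw [this, map_zero]
  rfl

/-- **Corollary.**  Under the hypotheses of the box lemma with `A ⊆ Y`, every point of `A` is saturated in `Y` in every block
outside `J`. -/
theorem sat_of_tight (blk : Fin M → Fin n) (Y : Finset (Fin M → ZMod 2)) (A : AffineSubspace (ZMod 2) (Fin M → ZMod 2))
    (hA : ∀ z ∈ A, z ∈ Y) (y : Fin M → ZMod 2) (hy : y ∈ A) (J : Finset (Fin n))
    (hJ : ∀ j ∈ J, ∀ z ∈ A, ¬ (∀ i, blk i = j → z i = 0))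
    (htight : M ≤ Module.finrank (ZMod 2) A.direction + J.card)
    (a : Fin M → ZMod 2) (ha : a ∈ A) (k : Fin n) (hk : k ∉ J)
    (w : Fin M → ZMod 2) (hw : ∀ i, blk i ≠ k → w i = 0) : a + w ∈ Y := by
  have hwd : w ∈ A.direction :=
    mem_direction_of_tight blk A y hy J hJ htight w (fun i hi => hw i (fun h => hk (h ▸ hi)))
  have := AffineSubspace.vadd_mem_of_mem_direction hwd ha
  rw [vadd_eq_add, add_comm] at this
  exact hA _ this

/-- The flat lemma is an equality under the hypotheses of the box lemma. -/
theorem finrank_direction_add_card_eq (blk : Fin M → Fin n) (A : AffineSubspace (ZMod 2) (Fin M → ZMod 2))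
    (y : Fin M → ZMod 2) (hy : y ∈ A) (J : Finset (Fin n))
    (hJ : ∀ j ∈ J, ∀ z ∈ A, ¬ (∀ i, blk i = j → z i = 0))
    (htight : M ≤ Module.finrank (ZMod 2) A.direction + J.card) :
    Module.finrank (ZMod 2) A.direction + J.card = M :=
  le_antisymm (finrank_direction_add_card_le blk A y hy J hJ) htight

/-! ## Appendix (same session): the kernel of the block functionals and the SKEW LEMMA

For a flat `A` zero-avoiding on the blocks of `J`, the functionals `f_j ∘ π_j` (`j ∈ J`) define `Ψ : 𝔽₂^M → 𝔽₂^J`, onto, with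
`A.direction ≤ ker Ψ`, `dim ker Ψ + |J| = M`, and `ker Ψ ⊇ V_k := range π_k` for every block `k ∉ J` (`exists_kernel`).  Writing
`skew := (M − dim A) − |J| ≥ 0` (the flat lemma's slack), the modular law gives the **skew lemma** (`bsize_add_le_finrank_inf`):
`dim (A.direction ⊓ V_k) ≥ b_k − skew` for every `k ∉ J` — a flat of skew `s` is `2^{−s}`-SATURATED in every block off `J` (skew `0` is the box lemma).
This is the structural input for the multi-block levels of the skew form `Σ_j excess_j ≤ Σ_y skew(y)` of the certificate (folder census 2026-08-31:
single-block level proved in `…CoordHallOne.lean`; skew-1 points onto `j, k` are half-saturated in the `jk`-cell).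
-/

/-- The unit vectors of block `k` lie in the range of the block-`k` projection, so `b_k ≤ dim (range π_k)`. -/
theorem bsize_le_finrank_range_blockProj (blk : Fin M → Fin n) (k : Fin n) :
    bsize blk k ≤ Module.finrank (ZMod 2) (LinearMap.range (blockProj blk k)) := by
  classical
  let v : {i : Fin M // blk i = k} → (Fin M → ZMod 2) := fun i => Pi.basisFun (ZMod 2) (Fin M) (i : Fin M)
  have hv : LinearIndependent (ZMod 2) v :=
    (Pi.basisFun (ZMod 2) (Fin M)).linearIndependent.comp (fun i : {i : Fin M // blk i = k} => (i : Fin M))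
      Subtype.val_injective
  have hle : Submodule.span (ZMod 2) (Set.range v) ≤ LinearMap.range (blockProj blk k) := by
    rw [Submodule.span_le]
    rintro _ ⟨i, rfl⟩
    refine ⟨Pi.single (i : Fin M) 1, ?_⟩
    show blockProj blk k (Pi.single (i : Fin M) 1) = Pi.basisFun (ZMod 2) (Fin M) (i : Fin M)
    rw [Pi.basisFun_apply]
    funext i'
    rw [blockProj_apply]
    by_cases h : blk i' = k
    · rw [if_pos h]
    · rw [if_neg h]
      have : (i : Fin M) ≠ i' := fun h' => h (h' ▸ i.2)
      rw [Pi.single_eq_of_ne (Ne.symm this)]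
  calc bsize blk k = Fintype.card {i : Fin M // blk i = k} := by rw [Fintype.card_subtype]; rfl
    _ = Module.finrank (ZMod 2) (Submodule.span (ZMod 2) (Set.range v)) := (finrank_span_eq_card hv).symm
    _ ≤ _ := Submodule.finrank_mono hle

/-- **Kernel of the block functionals.**  For a flat through `y` zero-avoiding on the blocks of `J` there is a subspace `K` (the kernel of
`Ψ = (f_j ∘ π_j)_{j∈J}`) with `A.direction ≤ K`, `dim K + |J| = M`, containing the range of every block projection off `J`. -/
theorem exists_kernel (blk : Fin M → Fin n) (A : AffineSubspace (ZMod 2) (Fin M → ZMod 2))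
    (y : Fin M → ZMod 2) (hy : y ∈ A) (J : Finset (Fin n))
    (hJ : ∀ j ∈ J, ∀ z ∈ A, ¬ (∀ i, blk i = j → z i = 0)) :
    ∃ K : Submodule (ZMod 2) (Fin M → ZMod 2), A.direction ≤ K ∧ Module.finrank (ZMod 2) K + J.card = M ∧
      ∀ k : Fin n, k ∉ J → LinearMap.range (blockProj blk k) ≤ K := by
  have hf : ∀ j : J, ∃ f : Module.Dual (ZMod 2) (Fin M → ZMod 2),
      (∀ d ∈ A.direction, f (blockProj blk j d) = 0) ∧ f (blockProj blk j y) = 1 :=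
    fun j => exists_dual_blockProj blk A y hy j (hJ j j.2)
  choose f hf0 hf1 using hf
  let Ψ : (Fin M → ZMod 2) →ₗ[ZMod 2] (J → ZMod 2) := LinearMap.pi fun j : J => (f j).comp (blockProj blk j)
  have hΨ : ∀ v : Fin M → ZMod 2, ∀ j : J, Ψ v j = f j (blockProj blk j v) := fun v j => rfl
  have hker : A.direction ≤ LinearMap.ker Ψ := by
    intro d hd
    rw [LinearMap.mem_ker]
    funext j
    rw [hΨ, hf0 j d hd]
    rfl
  have hsingle : ∀ j₀ : J, Ψ (blockProj blk j₀ y) = Pi.single j₀ 1 := by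
    intro j₀
    funext j
    rw [hΨ]
    by_cases h : j = j₀
    · subst h
      rw [blockProj_blockProj_self, hf1, Pi.single_eq_same]
    · have hne : (j : Fin n) ≠ (j₀ : Fin n) := fun h' => h (Subtype.ext h')
      rw [blockProj_blockProj_of_ne blk hne, map_zero, Pi.single_eq_of_ne h]
  have hrange : LinearMap.range Ψ = ⊤ := by
    rw [eq_top_iff]
    intro u _
    rw [pi_eq_sum_univ u]
    refine Submodule.sum_mem _ fun j _ => Submodule.smul_mem _ _ ?_
    have : (fun j' : J => if j = j' then (1 : ZMod 2) else 0) = Pi.single j 1 := by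
      funext j'
      by_cases h : j = j'
      · subst h; simp
      · rw [if_neg h, Pi.single_eq_of_ne (Ne.symm h)]
    rw [this, ← hsingle j]
    exact LinearMap.mem_range_self Ψ _
  have hrn := LinearMap.finrank_range_add_finrank_ker Ψ
  rw [hrange, finrank_top, Module.finrank_fintype_fun_eq_card, Module.finrank_fintype_fun_eq_card,
    Fintype.card_coe, Fintype.card_fin] at hrn
  refine ⟨LinearMap.ker Ψ, hker, by omega, fun k hk => ?_⟩
  rintro _ ⟨w, rfl⟩
  rw [LinearMap.mem_ker]
  funext j
  rw [hΨ]
  have hne : (j : Fin n) ≠ k := fun h => hk (h ▸ j.2)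
  rw [blockProj_blockProj_of_ne blk hne, map_zero]
  rfl

/-- **Skew lemma.**  A flat through `y` zero-avoiding on the blocks of `J` with flat-lemma slack `skew = (M − dim A) − |J|` meets the direction
space of every block `k ∉ J` in dimension at least `b_k − skew`:  `b_k + dim A + |J| ≤ dim (A.direction ⊓ range π_k) + M`. -/
theorem bsize_add_le_finrank_inf (blk : Fin M → Fin n) (A : AffineSubspace (ZMod 2) (Fin M → ZMod 2))
    (y : Fin M → ZMod 2) (hy : y ∈ A) (J : Finset (Fin n))
    (hJ : ∀ j ∈ J, ∀ z ∈ A, ¬ (∀ i, blk i = j → z i = 0)) (k : Fin n) (hk : k ∉ J) :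
    bsize blk k + Module.finrank (ZMod 2) A.direction + J.card ≤
      Module.finrank (ZMod 2) (A.direction ⊓ LinearMap.range (blockProj blk k) : Submodule (ZMod 2) (Fin M → ZMod 2)) + M := by
  obtain ⟨K, hDK, hK, hVK⟩ := exists_kernel blk A y hy J hJ
  have hmod := Submodule.finrank_sup_add_finrank_inf_eq A.direction (LinearMap.range (blockProj blk k))
  have hsup : Module.finrank (ZMod 2) (A.direction ⊔ LinearMap.range (blockProj blk k) : Submodule (ZMod 2) (Fin M → ZMod 2)) ≤
      Module.finrank (ZMod 2) K :=
    Submodule.finrank_mono (sup_le hDK (hVK k hk))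
  have hb := bsize_le_finrank_range_blockProj blk k
  omega

end Summit.PneNP.PneNP.Theorems.ClusCoordBox
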